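import Summits.AtomisticToContinuum.BoseEinsteinCondensation.Theorems.BECConjugateDominationHardCoreExtensionNearMinTower
import Summits.AtomisticToContinuum.BoseEinsteinCondensation.Theorems.BECConjugateDominationHardCoreExtensionTowerNearMinLimit
import Literature.MathematicalPhysics.QuantumManyBody.CondensateOccupationStability
import HarnessLib

/-!
# Necessity (core): periodic BEC of `v` forces near-minimiser BEC along every tower of minorants, given strong core density
# (crux `BECConjugateDomination.HardCoreExtension`, stmt-AtomisticToContinuum-11786 — line `near-minimiser-slack-transfer`, lead c7)

Sequel of `…HardCoreExtensionNearMinTower.lean` (the transfer: tower BEC ⇒ `PeriodicBEC(v)`) and of the landed worker stub S-A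
`stub_towerNearMinLimit` (Rellich compactness of near-minimisers along a tower with the `L²`-convergent subsequence exposed).
The CONVERSE of the transfer, modulo ONE fixed-volume input stated as the hypothesis `happrox` — strong density of the
normalised Bose `C¹` core in the unit sphere of the maximal `v`-form domain (B. Simon's "maximal = minimal form"; the SHAPE of
the line's stub S-B `stub_maxFormApproximationFiniteRange` and of the landed integrable case `exists_trialState_maxForm_approx`):

* `towerNearMinBEC_of_nearMinBEC_fixedVolume_of_approx` — at fixed `(N, L)`: if every `δ`-near-minimiser of `v` has
  `n₀ ≥ a`, then beyond some level every `δ/2`-near-minimiser of `wₙ` has `n₀ ≥ a − θ` (a deficient near-minimiser far out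
  in the tower would have an `L²`-limit of finite maximal `v`-form energy, approximable by a genuine near-minimiser of `v`,
  condensed by hypothesis, while `n₀` is `2N`-Lipschitz — `abs_toReal_condensateOccupation_sub_le`);
* `towerBEC_of_periodicBEC_of_approx` — thermodynamic form: `PeriodicBEC(v)` ⇒ near-minimiser BEC along every monotone
  measurable tower of minorants `wₙ ↑ v`, slack level-uniform, fraction halved;
* `towerBEC_of_periodicBEC_of_integrable` — UNCONDITIONAL for integrable interactions (`∫_{cell} W_v < ⊤` at every volume),
  by the landed `exists_trialState_maxForm_approx`;
* `nearMinimiserTowerBEC_iff_singleGoodLevel` — T★(v) ⟺ eventually in `N` ONE level `m(N)` whose condensation slack beats its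
  energy deficit `E₀(v) − E₀(min(v,m))` at the volume `L_N` (no compactness): the thermodynamic content of the crux is a
  near-minimiser BEC theorem for one bounded potential per `N` with a QUANTIFIED energy window.

The hard-core instance (all repulsive finite-range `v`) is `…NearMinTowerNecessity.lean`, fed with S-B.

References: E. H. Lieb, R. Seiringer, J. P. Solovej, J. Yngvason, *The Mathematics of the Bose Gas and its Condensation*
(2005), §1.2 (1.17)–(1.19), App. A (A.11)–(A.13), Ch. 5 p. 42; M. Reed, B. Simon, *Methods of Modern Mathematical Physics
IV* (1978), Thm XIII.64; B. Simon, J. Operator Theory 1 (1979) 37–47, Thm 2.1.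
-/

noncomputable section

namespace Summit.AtomisticToContinuum.BoseEinsteinCondensation.Cruxes.HardCoreExtension.NearMinTower

open MeasureTheory Filter
open scoped ENNReal NNReal Topology
open Literature.MathematicalPhysics.QuantumManyBody.BoseGas
open Summit.AtomisticToContinuum.BoseEinsteinCondensation.Theses.BECConjugateDomination
open UnitAddTorus
open Summit.AtomisticToContinuum.BoseEinsteinCondensation.Cruxes.StaticResponseBound.UvThomsonForceWave
  (measurable_zeroProfile lintegral_periodicInteraction_zero_ne_top)

attribute [local instance] Literature.MathematicalPhysics.QuantumManyBody.BoseGas.formDomain_measureSpace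
  Literature.MathematicalPhysics.QuantumManyBody.BoseGas.formDomain_isProbabilityMeasure
  Literature.MathematicalPhysics.QuantumManyBody.BoseGas.formDomain_isProbabilityMeasure_pi

open scoped InnerProductSpace

/-! ## Necessity at fixed volume and in the thermodynamic limit, given strong core density -/

/-- **Dictionary**: the `L²((ℝ/ℤ)^{3N})`-distance of two embedded periodic trial states is their `L²(cell)` distance,
`‖ι Ψ − ι Φ‖² = ∫_{[0,L)^{3N}} ‖Ψ − Φ‖²` (linearity of the graph embedding on the core and `norm_formEmbed_graphEmbed_sq`).
[cite: ReedSimonIV1978, Thm XIII.64] -/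
theorem norm_formEmbed_sub_formEmbed_sq {N : ℕ} {L : ℝ} (hL : 0 < L) (Ψ Φ : PeriodicTrialState N L) :
    ‖formEmbed hL measurable_zeroProfile (lintegral_periodicInteraction_zero_ne_top N L)
        ⟨graphEmbed hL measurable_zeroProfile (lintegral_periodicInteraction_zero_ne_top N L)
          ⟨Ψ.ψ, Ψ.mem_periodicCore⟩,
          graphEmbed_mem_formDomain hL measurable_zeroProfile (lintegral_periodicInteraction_zero_ne_top N L) _⟩ -
      formEmbed hL measurable_zeroProfile (lintegral_periodicInteraction_zero_ne_top N L)
        ⟨graphEmbed hL measurable_zeroProfile (lintegral_periodicInteraction_zero_ne_top N L)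
          ⟨Φ.ψ, Φ.mem_periodicCore⟩,
          graphEmbed_mem_formDomain hL measurable_zeroProfile (lintegral_periodicInteraction_zero_ne_top N L) _⟩‖ ^ 2 =
      ∫ X in cellN N L, ‖Ψ.ψ X - Φ.ψ X‖ ^ 2 := by
  -- linearity of `f ↦ ι(graphEmbed f)` on the core
  let G := LinearMap.codRestrict (formDomain hL measurable_zeroProfile (lintegral_periodicInteraction_zero_ne_top N L))
    (graphEmbed hL measurable_zeroProfile (lintegral_periodicInteraction_zero_ne_top N L))
    (graphEmbed_mem_formDomain hL measurable_zeroProfile (lintegral_periodicInteraction_zero_ne_top N L))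
  change ‖formEmbed hL measurable_zeroProfile (lintegral_periodicInteraction_zero_ne_top N L)
      (G ⟨Ψ.ψ, Ψ.mem_periodicCore⟩) -
    formEmbed hL measurable_zeroProfile (lintegral_periodicInteraction_zero_ne_top N L)
      (G ⟨Φ.ψ, Φ.mem_periodicCore⟩)‖ ^ 2 = _
  rw [← map_sub, ← map_sub]
  change ‖formEmbed hL measurable_zeroProfile (lintegral_periodicInteraction_zero_ne_top N L)
      ⟨graphEmbed hL measurable_zeroProfile (lintegral_periodicInteraction_zero_ne_top N L)
        (⟨Ψ.ψ, Ψ.mem_periodicCore⟩ - ⟨Φ.ψ, Φ.mem_periodicCore⟩),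
        graphEmbed_mem_formDomain hL measurable_zeroProfile (lintegral_periodicInteraction_zero_ne_top N L) _⟩‖ ^ 2 = _
  rw [norm_formEmbed_graphEmbed_sq, Submodule.coe_sub]
  -- `∫⁻ ‖Ψ - Φ‖₊² = ofReal ∫ ‖Ψ - Φ‖²`
  have hcont : Continuous (Ψ.ψ - Φ.ψ) := Ψ.contDiff.continuous.sub Φ.contDiff.continuous
  have h := lintegral_cellN_nnnorm_sq_eq_ofReal L hcont
  have hnn : 0 ≤ ∫ X in cellN N L, ‖(Ψ.ψ - Φ.ψ) X‖ ^ 2 := integral_nonneg fun X => by positivity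
  show (∫⁻ X in cellN N L, (‖(Ψ.ψ - Φ.ψ) X‖₊ : ℝ≥0∞) ^ 2).toReal = ∫ X in cellN N L, ‖Ψ.ψ X - Φ.ψ X‖ ^ 2
  rw [h, ENNReal.toReal_ofReal hnn]
  rfl

/-- **Necessity at fixed volume, given strong density of the core in the maximal `v`-form at `(N, L)`** (`happrox`, the
shape of S-B / of the landed integrable `exists_trialState_maxForm_approx`): if every `δ`-near-minimiser of `v` at `(N, L)` has
`n₀ ≥ a` (`0 < δ < ⊤`, `E₀(v) < ⊤`), then for every `θ > 0` there is a level `n₀` beyond which every `δ/2`-near-minimiser of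
`wₙ` has `n₀ ≥ a − θ`, for any monotone measurable tower of minorants `wₙ ↑ v` (S-A compactness + `happrox` + `n₀` is
`2N`-Lipschitz). [cite: LSSY2005, App. A (A.11)–(A.13); ReedSimonIV1978, Thm XIII.64] -/
theorem towerNearMinBEC_of_nearMinBEC_fixedVolume_of_approx (v : ℝ → ℝ≥0∞) (hv : IsRepulsiveFiniteRange v)
    (w : ℕ → ℝ → ℝ≥0∞) (hwm : ∀ n, Measurable (w n)) (hmono : ∀ n r, w n r ≤ w (n + 1) r)
    (hsup : ∀ r, ⨆ n, w n r = v r) {N : ℕ} {L : ℝ} (hL : 0 < L) (hE : periodicGroundStateEnergy v N L ≠ ⊤)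
    (happrox : ∀ η : Lp ℂ 2 (volume : Measure (UnitAddTorus (Fin N × Fin 3))), ‖η‖ = 1 →
        (∀ (σ : Equiv.Perm (Fin N)) (n : Fin N × Fin 3 → ℤ),
          ⟪(mFourierLp 2 (fun p : Fin N × Fin 3 => n (σ p.1, p.2)) :
              Lp ℂ 2 (volume : Measure (UnitAddTorus (Fin N × Fin 3)))), η⟫_ℂ =
            ⟪(mFourierLp 2 n : Lp ℂ 2 (volume : Measure (UnitAddTorus (Fin N × Fin 3)))), η⟫_ℂ) →
        (∑' n : Fin N × Fin 3 → ℤ, ENNReal.ofReal (∑ p, (2 * Real.pi * (n p : ℝ) / L) ^ 2) *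
              (‖⟪(mFourierLp 2 n : Lp ℂ 2 (volume : Measure (UnitAddTorus (Fin N × Fin 3)))), η⟫_ℂ‖₊ :
                ℝ≥0∞) ^ 2 +
            ∫⁻ t, periodicInteraction v L (fromUnitTorusN L t) *
              (‖(η : UnitAddTorus (Fin N × Fin 3) → ℂ) t‖₊ : ℝ≥0∞) ^ 2) ≠ ⊤ →
        ∀ ε : ℝ, 0 < ε → ∃ Φ : PeriodicTrialState N L,
          periodicEnergy v Φ ≤
            (∑' n : Fin N × Fin 3 → ℤ, ENNReal.ofReal (∑ p, (2 * Real.pi * (n p : ℝ) / L) ^ 2) *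
                (‖⟪(mFourierLp 2 n : Lp ℂ 2 (volume : Measure (UnitAddTorus (Fin N × Fin 3)))), η⟫_ℂ‖₊ :
                  ℝ≥0∞) ^ 2 +
              ∫⁻ t, periodicInteraction v L (fromUnitTorusN L t) *
                (‖(η : UnitAddTorus (Fin N × Fin 3) → ℂ) t‖₊ : ℝ≥0∞) ^ 2) + ENNReal.ofReal ε ∧
          ‖formEmbed hL measurable_zeroProfile (lintegral_periodicInteraction_zero_ne_top N L)
              ⟨graphEmbed hL measurable_zeroProfile (lintegral_periodicInteraction_zero_ne_top N L)
                ⟨Φ.ψ, Φ.mem_periodicCore⟩,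
                graphEmbed_mem_formDomain hL measurable_zeroProfile
                  (lintegral_periodicInteraction_zero_ne_top N L) _⟩ - η‖ ≤ ε)
    {δ : ℝ≥0∞} (hδ : 0 < δ) (hδtop : δ ≠ ⊤) {a : ℝ}
    (hBEC : ∀ Ψ : PeriodicTrialState N L, periodicEnergy v Ψ ≤ periodicGroundStateEnergy v N L + δ →
      ENNReal.ofReal a ≤ condensateOccupation N L Ψ.ψ)
    {θ : ℝ} (hθ : 0 < θ) :
    ∃ n₀ : ℕ, ∀ n : ℕ, n₀ ≤ n → ∀ Ψ : PeriodicTrialState N L,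
      periodicEnergy (w n) Ψ ≤ periodicGroundStateEnergy (w n) N L + δ / 2 →
        ENNReal.ofReal (a - θ) ≤ condensateOccupation N L Ψ.ψ := by
  by_contra hcon
  push Not at hcon
  -- a sequence of levels `k j ≥ j` and deficient `δ/2`-near-minimisers `Ψ j` of `w (k j)`
  choose k hk Ψ hΨE hΨn using hcon
  have hktend : Tendsto k atTop atTop := tendsto_atTop_mono hk tendsto_id
  have hδ2top : δ / 2 ≠ ⊤ := ENNReal.div_ne_top hδtop two_ne_zero
  -- S-A: the `L²`-limit `η` along a subsequence
  obtain ⟨η, hη1, hηsymm, hηE, φ, hφ, hconv⟩ :=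
    stub_towerNearMinLimit v hv w hwm hmono hsup N L hL hE (δ / 2) hδ2top k hktend Ψ hΨE
  -- the accuracy `ε`
  have hδ2pos : 0 < (δ / 2).toReal := ENNReal.toReal_pos (ENNReal.half_pos hδ.ne').ne' hδ2top
  set ε : ℝ := min ((δ / 2).toReal) (θ / (4 * N + 1)) with hεdef
  have hεpos : 0 < ε := lt_min hδ2pos (by positivity)
  have hεδ : ENNReal.ofReal ε ≤ δ / 2 := by
    rw [← ENNReal.ofReal_toReal hδ2top]
    exact ENNReal.ofReal_le_ofReal (min_le_left _ _)
  have hεθ : 4 * N * ε ≤ θ := by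
    have h1 : ε ≤ θ / (4 * N + 1) := min_le_right _ _
    have h2 : (0 : ℝ) ≤ 4 * N := by positivity
    calc 4 * N * ε ≤ (4 * N + 1) * ε := by nlinarith [hεpos.le]
      _ ≤ (4 * N + 1) * (θ / (4 * N + 1)) := by gcongr
      _ = θ := mul_div_cancel₀ θ (by positivity)
  -- finiteness of the maximal form energy of `η`
  have hηEtop : (∑' n : Fin N × Fin 3 → ℤ, ENNReal.ofReal (∑ p, (2 * Real.pi * (n p : ℝ) / L) ^ 2) *
        (‖⟪(mFourierLp 2 n : Lp ℂ 2 (volume : Measure (UnitAddTorus (Fin N × Fin 3)))), η⟫_ℂ‖₊ : ℝ≥0∞) ^ 2 +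
      ∫⁻ t, periodicInteraction v L (fromUnitTorusN L t) *
        (‖(η : UnitAddTorus (Fin N × Fin 3) → ℂ) t‖₊ : ℝ≥0∞) ^ 2) ≠ ⊤ :=
    ne_top_of_le_ne_top (ENNReal.add_ne_top.2 ⟨hE, hδ2top⟩) hηE
  -- S-B: a core state `Φ` close to `η` in energy and in `L²`
  obtain ⟨Φ, hΦE, hΦdist⟩ := happrox η hη1 hηsymm hηEtop ε hεpos
  -- `Φ` is a `δ`-near-minimiser of `v`, hence condensed
  have hΦnear : periodicEnergy v Φ ≤ periodicGroundStateEnergy v N L + δ :=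
    calc periodicEnergy v Φ ≤ periodicGroundStateEnergy v N L + δ / 2 + ENNReal.ofReal ε := hΦE.trans (by gcongr)
      _ ≤ periodicGroundStateEnergy v N L + δ / 2 + δ / 2 := by gcongr
      _ = periodicGroundStateEnergy v N L + δ := by rw [add_assoc, ENNReal.add_halves]
  have hΦcond := hBEC Φ hΦnear
  -- a member of the subsequence `ε`-close to `η`
  obtain ⟨j, hj⟩ := (Metric.tendsto_atTop.1 hconv ε hεpos).imp fun j h => h j le_rfl
  rw [dist_eq_norm] at hj
  -- `L²(cell)` distance of `Φ` and `Ψ (φ j)`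
  have hsq := norm_formEmbed_sub_formEmbed_sq hL Φ (Ψ (φ j))
  set ιΦ := formEmbed hL measurable_zeroProfile (lintegral_periodicInteraction_zero_ne_top N L)
      ⟨graphEmbed hL measurable_zeroProfile (lintegral_periodicInteraction_zero_ne_top N L)
        ⟨Φ.ψ, Φ.mem_periodicCore⟩, graphEmbed_mem_formDomain hL measurable_zeroProfile
          (lintegral_periodicInteraction_zero_ne_top N L) _⟩ with hιΦ
  set ιΨ := formEmbed hL measurable_zeroProfile (lintegral_periodicInteraction_zero_ne_top N L)
      ⟨graphEmbed hL measurable_zeroProfile (lintegral_periodicInteraction_zero_ne_top N L)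
        ⟨(Ψ (φ j)).ψ, (Ψ (φ j)).mem_periodicCore⟩, graphEmbed_mem_formDomain hL measurable_zeroProfile
          (lintegral_periodicInteraction_zero_ne_top N L) _⟩ with hιΨ
  have htri : ‖ιΦ - ιΨ‖ ≤ 2 * ε := by
    have h := dist_triangle_right ιΦ ιΨ η
    simp only [dist_eq_norm] at h
    linarith [hΦdist, hj.le]
  have hdist : Real.sqrt (∫ X in cellN N L, ‖Φ.ψ X - (Ψ (φ j)).ψ X‖ ^ 2) ≤ 2 * ε := by
    rw [← hsq, Real.sqrt_sq (norm_nonneg _)]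
    exact htri
  -- `n₀` is `2N`-Lipschitz on the unit sphere of `L²(cell)`
  have hLip := abs_toReal_condensateOccupation_sub_le hL Φ.contDiff.continuous (Ψ (φ j)).contDiff.continuous
    Φ.norm_eq.le (Ψ (φ j)).norm_eq.le
  have hfinΦ : condensateOccupation N L Φ.ψ ≠ ⊤ :=
    condensateOccupation_ne_top_of_lintegral_le_one hL Φ.contDiff.continuous Φ.norm_eq.le
  have hfinΨ : condensateOccupation N L (Ψ (φ j)).ψ ≠ ⊤ :=
    condensateOccupation_ne_top_of_lintegral_le_one hL (Ψ (φ j)).contDiff.continuous (Ψ (φ j)).norm_eq.le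
  have ha : a ≤ (condensateOccupation N L Φ.ψ).toReal := by
    have := ENNReal.toReal_mono hfinΦ hΦcond
    by_cases ha0 : 0 ≤ a
    · rwa [ENNReal.toReal_ofReal ha0] at this
    · exact (not_le.1 ha0).le.trans ENNReal.toReal_nonneg
  have hN0 : (0 : ℝ) ≤ N := Nat.cast_nonneg N
  have hkey : a - θ ≤ (condensateOccupation N L (Ψ (φ j)).ψ).toReal := by
    have h1 := (abs_sub_le_iff.1 hLip).1
    have h2 : 2 * N * Real.sqrt (∫ X in cellN N L, ‖Φ.ψ X - (Ψ (φ j)).ψ X‖ ^ 2) ≤ 2 * N * (2 * ε) :=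
      mul_le_mul_of_nonneg_left hdist (by positivity)
    nlinarith
  have := hΨn (φ j)
  rw [← ENNReal.ofReal_toReal hfinΨ] at this
  exact absurd (ENNReal.ofReal_le_ofReal hkey) (not_le.2 this)

/-- **Necessity, thermodynamic form, given strong core density in the maximal `v`-form at every volume** (`happrox`):
`PeriodicBEC(v)` ⇒ near-minimiser BEC along every monotone measurable tower of minorants `wₙ ↑ v`, slack level-uniform,
fraction halved. [cite: LSSY2005, §1.2 (1.19) and Ch. 5 p. 42] -/
theorem towerBEC_of_periodicBEC_of_approx (v : ℝ → ℝ≥0∞) (hv : IsRepulsiveFiniteRange v)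
    (w : ℕ → ℝ → ℝ≥0∞) (hwm : ∀ n, Measurable (w n)) (hmono : ∀ n r, w n r ≤ w (n + 1) r)
    (hsup : ∀ r, ⨆ n, w n r = v r)
    (happrox : ∀ (N : ℕ) (L : ℝ) (hL : 0 < L),
      ∀ η : Lp ℂ 2 (volume : Measure (UnitAddTorus (Fin N × Fin 3))), ‖η‖ = 1 →
        (∀ (σ : Equiv.Perm (Fin N)) (n : Fin N × Fin 3 → ℤ),
          ⟪(mFourierLp 2 (fun p : Fin N × Fin 3 => n (σ p.1, p.2)) :
              Lp ℂ 2 (volume : Measure (UnitAddTorus (Fin N × Fin 3)))), η⟫_ℂ =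
            ⟪(mFourierLp 2 n : Lp ℂ 2 (volume : Measure (UnitAddTorus (Fin N × Fin 3)))), η⟫_ℂ) →
        (∑' n : Fin N × Fin 3 → ℤ, ENNReal.ofReal (∑ p, (2 * Real.pi * (n p : ℝ) / L) ^ 2) *
              (‖⟪(mFourierLp 2 n : Lp ℂ 2 (volume : Measure (UnitAddTorus (Fin N × Fin 3)))), η⟫_ℂ‖₊ :
                ℝ≥0∞) ^ 2 +
            ∫⁻ t, periodicInteraction v L (fromUnitTorusN L t) *
              (‖(η : UnitAddTorus (Fin N × Fin 3) → ℂ) t‖₊ : ℝ≥0∞) ^ 2) ≠ ⊤ →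
        ∀ ε : ℝ, 0 < ε → ∃ Φ : PeriodicTrialState N L,
          periodicEnergy v Φ ≤
            (∑' n : Fin N × Fin 3 → ℤ, ENNReal.ofReal (∑ p, (2 * Real.pi * (n p : ℝ) / L) ^ 2) *
                (‖⟪(mFourierLp 2 n : Lp ℂ 2 (volume : Measure (UnitAddTorus (Fin N × Fin 3)))), η⟫_ℂ‖₊ :
                  ℝ≥0∞) ^ 2 +
              ∫⁻ t, periodicInteraction v L (fromUnitTorusN L t) *
                (‖(η : UnitAddTorus (Fin N × Fin 3) → ℂ) t‖₊ : ℝ≥0∞) ^ 2) + ENNReal.ofReal ε ∧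
          ‖formEmbed hL measurable_zeroProfile (lintegral_periodicInteraction_zero_ne_top N L)
              ⟨graphEmbed hL measurable_zeroProfile (lintegral_periodicInteraction_zero_ne_top N L)
                ⟨Φ.ψ, Φ.mem_periodicCore⟩,
                graphEmbed_mem_formDomain hL measurable_zeroProfile
                  (lintegral_periodicInteraction_zero_ne_top N L) _⟩ - η‖ ≤ ε)
    (hP : ∃ ρ₀ : ℝ, 0 < ρ₀ ∧ ∀ ρ : ℝ, 0 < ρ → ρ < ρ₀ → ∃ c : ℝ, 0 < c ∧ ∀ᶠ N : ℕ in atTop,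
      ∃ δ : ℝ≥0∞, 0 < δ ∧ ∀ Ψ : PeriodicTrialState N (sideLength ρ N),
        periodicEnergy v Ψ ≤ periodicGroundStateEnergy v N (sideLength ρ N) + δ →
          ENNReal.ofReal (c * N) ≤ condensateOccupation N (sideLength ρ N) Ψ.ψ) :
    ∃ ρ₀ : ℝ, 0 < ρ₀ ∧ ∀ ρ : ℝ, 0 < ρ → ρ < ρ₀ → ∃ c : ℝ, 0 < c ∧ ∀ᶠ N : ℕ in atTop,
        ∃ δ : ℝ≥0∞, 0 < δ ∧ ∃ n₀ : ℕ, ∀ n : ℕ, n₀ ≤ n →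
          ∀ Ψ : PeriodicTrialState N (sideLength ρ N),
            periodicEnergy (w n) Ψ ≤ periodicGroundStateEnergy (w n) N (sideLength ρ N) + δ →
              ENNReal.ofReal (c * N) ≤ condensateOccupation N (sideLength ρ N) Ψ.ψ := by
  obtain ⟨ρ₀, hρ₀, hth⟩ := hP
  obtain ⟨ρF, hρF, hfin⟩ :=
    Literature.Barriers.AtomisticToContinuum.BoseGas.exists_eventually_periodicGroundStateEnergy_lt_top hv
  refine ⟨min ρ₀ ρF, lt_min hρ₀ hρF, fun ρ hρ hρlt => ?_⟩
  obtain ⟨c, hc, hN⟩ := hth ρ hρ (hρlt.trans_le (min_le_left _ _))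
  refine ⟨c / 2, half_pos hc, ?_⟩
  filter_upwards [hN, hfin ρ hρ (hρlt.trans_le (min_le_right _ _)), eventually_gt_atTop 0] with N hN₁ hN₂ hN₃
  obtain ⟨δ, hδ, hBEC⟩ := hN₁
  have hL : 0 < sideLength ρ N := sideLength_pos_of_pos hρ hN₃
  -- a finite positive slack below `δ`
  set δ₁ : ℝ≥0∞ := min δ 1 with hδ₁
  have hδ₁pos : 0 < δ₁ := lt_min hδ one_pos
  have hδ₁top : δ₁ ≠ ⊤ := ne_top_of_le_ne_top ENNReal.one_ne_top (min_le_right _ _)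
  have hBEC₁ : ∀ Ψ : PeriodicTrialState N (sideLength ρ N),
      periodicEnergy v Ψ ≤ periodicGroundStateEnergy v N (sideLength ρ N) + δ₁ →
        ENNReal.ofReal (c * N) ≤ condensateOccupation N (sideLength ρ N) Ψ.ψ :=
    fun Ψ hΨ => hBEC Ψ (hΨ.trans (by gcongr; exact min_le_left _ _))
  have hθ : 0 < c * N / 2 := by have : (0 : ℝ) < N := Nat.cast_pos.2 hN₃; positivity
  obtain ⟨n₀, hn₀⟩ := towerNearMinBEC_of_nearMinBEC_fixedVolume_of_approx v hv w hwm hmono hsup hL hN₂.ne (happrox N _ hL)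
    hδ₁pos hδ₁top hBEC₁ hθ
  refine ⟨δ₁ / 2, ENNReal.half_pos hδ₁pos.ne', n₀, fun n hn Ψ hΨ => ?_⟩
  have h := hn₀ n hn Ψ hΨ
  have hcc : c * N - c * N / 2 = c / 2 * N := by ring
  rwa [hcc] at h

/-- **Necessity for INTEGRABLE interactions — unconditional** (`∫_{cell} W_v < ⊤` at every volume: bounded potentials,
integrable singularities; NOT hard cores): strong density is the landed `exists_trialState_maxForm_approx`
(B. Simon, J. Operator Theory 1 (1979) Thm 2.1). [cite: ReedSimonIV1978, Thm XIII.64] -/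
theorem towerBEC_of_periodicBEC_of_integrable :
    ∀ v : ℝ → ℝ≥0∞, IsRepulsiveFiniteRange v →
      (∀ (N : ℕ) (L : ℝ), 0 < L → ∫⁻ X in cellN N L, periodicInteraction v L X ≠ ⊤) →
      ∀ w : ℕ → ℝ → ℝ≥0∞, (∀ n, Measurable (w n)) → (∀ n r, w n r ≤ w (n + 1) r) → (∀ r, ⨆ n, w n r = v r) →
      (∃ ρ₀ : ℝ, 0 < ρ₀ ∧ ∀ ρ : ℝ, 0 < ρ → ρ < ρ₀ → ∃ c : ℝ, 0 < c ∧ ∀ᶠ N : ℕ in atTop,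
        ∃ δ : ℝ≥0∞, 0 < δ ∧ ∀ Ψ : PeriodicTrialState N (sideLength ρ N),
          periodicEnergy v Ψ ≤ periodicGroundStateEnergy v N (sideLength ρ N) + δ →
            ENNReal.ofReal (c * N) ≤ condensateOccupation N (sideLength ρ N) Ψ.ψ) →
      ∃ ρ₀ : ℝ, 0 < ρ₀ ∧ ∀ ρ : ℝ, 0 < ρ → ρ < ρ₀ → ∃ c : ℝ, 0 < c ∧ ∀ᶠ N : ℕ in atTop,
        ∃ δ : ℝ≥0∞, 0 < δ ∧ ∃ n₀ : ℕ, ∀ n : ℕ, n₀ ≤ n →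
          ∀ Ψ : PeriodicTrialState N (sideLength ρ N),
            periodicEnergy (w n) Ψ ≤ periodicGroundStateEnergy (w n) N (sideLength ρ N) + δ →
              ENNReal.ofReal (c * N) ≤ condensateOccupation N (sideLength ρ N) Ψ.ψ :=
  fun v hv hWint w hwm hmono hsup hP => towerBEC_of_periodicBEC_of_approx v hv w hwm hmono hsup
    (fun N L hL η hη hsymm hfin _ hε => exists_trialState_maxForm_approx hL measurable_zeroProfile
      (lintegral_periodicInteraction_zero_ne_top N L) hv.1 (hWint N L hL) η hη hsymm hfin hε) hP

/-! ## The single-good-level form of T★ (no compactness) -/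

/-- **T★(v) ⟺ "one good level per `N`"** (proved; `→` uses Ruelle finiteness and the landed truncation energy
convergence, `←` is slack matching down the tower). [cite: LSSY2005, §1.2 (1.19); ReedSimonIV1978, Thm XIII.64] -/
theorem nearMinimiserTowerBEC_iff_singleGoodLevel (v : ℝ → ℝ≥0∞) (hv : IsRepulsiveFiniteRange v) :
    (∃ ρ₀ : ℝ, 0 < ρ₀ ∧ ∀ ρ : ℝ, 0 < ρ → ρ < ρ₀ → ∃ c : ℝ, 0 < c ∧ ∀ᶠ N : ℕ in atTop,
        ∃ δ : ℝ≥0∞, 0 < δ ∧ ∃ n₀ : ℕ, ∀ n : ℕ, n₀ ≤ n →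
          ∀ Ψ : PeriodicTrialState N (sideLength ρ N),
            periodicEnergy (fun r => min (v r) (n : ℝ≥0∞)) Ψ ≤
                periodicGroundStateEnergy (fun r => min (v r) (n : ℝ≥0∞)) N (sideLength ρ N) + δ →
              ENNReal.ofReal (c * N) ≤ condensateOccupation N (sideLength ρ N) Ψ.ψ) ↔
    (∃ ρ₀ : ℝ, 0 < ρ₀ ∧ ∀ ρ : ℝ, 0 < ρ → ρ < ρ₀ → ∃ c : ℝ, 0 < c ∧ ∀ᶠ N : ℕ in atTop,
        ∃ m : ℕ, ∃ δ δ' : ℝ≥0∞, 0 < δ' ∧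
          periodicGroundStateEnergy v N (sideLength ρ N) + δ' ≤
            periodicGroundStateEnergy (fun r => min (v r) (m : ℝ≥0∞)) N (sideLength ρ N) + δ ∧
          ∀ Ψ : PeriodicTrialState N (sideLength ρ N),
            periodicEnergy (fun r => min (v r) (m : ℝ≥0∞)) Ψ ≤
                periodicGroundStateEnergy (fun r => min (v r) (m : ℝ≥0∞)) N (sideLength ρ N) + δ →
              ENNReal.ofReal (c * N) ≤ condensateOccupation N (sideLength ρ N) Ψ.ψ) := by
  constructor
  · rintro ⟨ρ₀, hρ₀, hth⟩
    obtain ⟨ρF, hρF, hfin⟩ :=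
      Literature.Barriers.AtomisticToContinuum.BoseGas.exists_eventually_periodicGroundStateEnergy_lt_top hv
    refine ⟨min ρ₀ ρF, lt_min hρ₀ hρF, fun ρ hρ hρlt => ?_⟩
    obtain ⟨c, hc, hN⟩ := hth ρ hρ (hρlt.trans_le (min_le_left _ _))
    refine ⟨c, hc, ?_⟩
    filter_upwards [hN, hfin ρ hρ (hρlt.trans_le (min_le_right _ _)), eventually_gt_atTop 0] with N hN₁ hN₂ hN₃
    obtain ⟨δ, hδ, n₀, h⟩ := hN₁
    have hL : 0 < sideLength ρ N := sideLength_pos_of_pos hρ hN₃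
    -- a finite positive slack below `δ`, and a level whose deficit is below half of it
    set δ₁ : ℝ≥0∞ := min δ 1 with hδ₁
    have hδ₁pos : 0 < δ₁ := lt_min hδ one_pos
    have hδ₁top : δ₁ ≠ ⊤ := ne_top_of_le_ne_top ENNReal.one_ne_top (min_le_right _ _)
    have hhalf_ne : δ₁ / 2 ≠ 0 := (ENNReal.half_pos hδ₁pos.ne').ne'
    have hhalf_top : δ₁ / 2 ≠ ⊤ := ENNReal.div_ne_top hδ₁top two_ne_zero
    obtain ⟨n₁, hn₁⟩ := ThirdLawCurrentFloorAlt.stub_truncationEnergyConvergenceAll v hv N (sideLength ρ N) hL hN₂.ne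
      ((δ₁ / 2).toReal) (ENNReal.toReal_pos hhalf_ne hhalf_top)
    refine ⟨max n₀ n₁, δ, δ₁ / 2, ENNReal.half_pos hδ₁pos.ne', ?_, h _ (le_max_left _ _)⟩
    calc periodicGroundStateEnergy v N (sideLength ρ N) + δ₁ / 2
        ≤ periodicGroundStateEnergy (fun r => min (v r) ((max n₀ n₁ : ℕ) : ℝ≥0∞)) N (sideLength ρ N) +
            ENNReal.ofReal ((δ₁ / 2).toReal) + δ₁ / 2 := by gcongr; exact hn₁ _ (le_max_right _ _)
      _ = periodicGroundStateEnergy (fun r => min (v r) ((max n₀ n₁ : ℕ) : ℝ≥0∞)) N (sideLength ρ N) + δ₁ := by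
          rw [ENNReal.ofReal_toReal hhalf_top, add_assoc, ENNReal.add_halves]
      _ ≤ _ := by gcongr; exact min_le_left _ _
  · rintro ⟨ρ₀, hρ₀, hth⟩
    refine ⟨ρ₀, hρ₀, fun ρ hρ hρlt => ?_⟩
    obtain ⟨c, hc, hN⟩ := hth ρ hρ hρlt
    refine ⟨c, hc, ?_⟩
    filter_upwards [hN] with N hN₁
    obtain ⟨m, δ, δ', hδ', hdef, h⟩ := hN₁
    refine ⟨δ', hδ', m, fun n hn Ψ hΨ => h Ψ ?_⟩
    have hmn : ∀ r, min (v r) (m : ℝ≥0∞) ≤ min (v r) (n : ℝ≥0∞) :=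
      fun r => min_le_min le_rfl (by exact_mod_cast hn)
    calc periodicEnergy (fun r => min (v r) (m : ℝ≥0∞)) Ψ
        ≤ periodicEnergy (fun r => min (v r) (n : ℝ≥0∞)) Ψ := periodicEnergy_mono_of_le hmn Ψ
      _ ≤ periodicGroundStateEnergy (fun r => min (v r) (n : ℝ≥0∞)) N (sideLength ρ N) + δ' := hΨ
      _ ≤ periodicGroundStateEnergy v N (sideLength ρ N) + δ' := by
          gcongr; exact periodicGroundStateEnergy_mono_of_le fun r => min_le_left _ _
      _ ≤ _ := hdef

end Summit.AtomisticToContinuum.BoseEinsteinCondensation.Cruxes.HardCoreExtension.NearMinTower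

end
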